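import Summits.Schanuel.Schanuel.Theorems.RootDecomp1KHeightBoundary01

/-!
# RootDecomp1KHeightBoundary (part 02 of 02: §4–§5) — census-1 g32 kernel scratch «HEIGHT-BOUNDARY» (INSTRUMENT OFFER 83 L3485;
  crit PRICE + GO L3486, terms r83-(i)–(xii), amendments L3490): §4 `geomIrreducible_W4P` hypothesis-free (the
  `x`-quadratic route (Q): content 1 + non-square discriminant, transported by `Bivariate.swap`), §5 the member `W4` at
  `m₀ = 2` on the boundary of node 12's grading.  See part 01 for the scope statement; ×0 re-grading, rung 0 —
  nothing here proves Schanuel, 33364 / 33363 / 31077 / 31987, `ThinFibre 2`, `ThinFibreAt 2 W4P` or `LevelFinite W4P`;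
  every statement using a binder carries it as an explicit hypothesis (`SqrtComparisonAt W4P` / `HeightComparisonSqrt` /
  `PadicSubspace`).  Imports: part 01 only.  No Literature import, no sorry, no set_option, no private, no instance, no notation.
-/

noncomputable section

namespace Summit.Schanuel.Schanuel.Theorems.RootDecomp1KHeightBoundary

open Polynomial LiouvilleNumber
open scoped Nat Polynomial.Bivariate
open Summit.Schanuel.Schanuel.Theorems.RootDecomp1KDegreeLadder
open Summit.Schanuel.Schanuel.Theorems.RootDecomp1KXTop (xPolyP)
open Summit.Schanuel.Schanuel.Theorems.RootDecomp1KLevelFinite (LevelFinite)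
open Summit.Schanuel.Schanuel.Theorems.RootDecomp1KHeightGrading
open Summit.Schanuel.Schanuel.Theorems.RootDecomp1KSubspaceBranch (PadicSubspace)
open Summit.Schanuel.Schanuel.Theorems.RootDecomp1KOddEmpty (W4P w4C vQ vG)
open Summit.Schanuel.Schanuel.Theorems.RootDecomp1KW4Dossier (natDegree_W4P xdeg_W4P thinFibreAt_W4P_of_padicSubspace)
open Summit.Schanuel.Schanuel.Theorems.RootDecomp1KSiegelFunctions (geomIrreducible_swap_iff)

/-! ### §4  `W4` is geometrically irreducible — hypothesis-free (route (Q) of crit L3490: the `x`-quadratic route)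

`GeomIrreducible W4P` (node 12's hypothesis class: `W4P` irreducible in `ℚ̄[x][Y]`).  The variables are exchanged by
Mathlib's `Polynomial.Bivariate.swap` and the tree's `RootDecomp1KSiegelFunctions.geomIrreducible_swap_iff` /
`map_swap` (no shift, no root extraction needed on this route): as a polynomial in `x` over `ℚ̄[Y]`,
`swap W4P = A·x² + B·x + C₀` with `A = Y⁴ − 17`, `B = Y³ + 1`, `C₀ = Y + 2` (`geomModel_swap_W4P`).  A factorisation in
`ℚ̄[Y][x]` is (0,2) or (1,1) by `x`-degree: a CONSTANT factor divides `A` and `B`, which are coprime —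
CERTIFICATE 1 (checked in-kernel by `ring`): `(−Y² + 17Y − 289)·A + (Y³ − 17Y² + 289Y − 1)·B = 4912`;
two `x`-LINEAR factors `(αx + β)(γx + δ)` force `B² − 4AC₀ = (αδ − βγ)²`, but the discriminant
`Δ = B² − 4AC₀ = Y⁶ − 4Y⁵ − 8Y⁴ + 2Y³ + 68Y + 137` (`geomDisc_eq`; the sextic of the K-line's genus-2 curve
`X : z² = Δ(Y)`, tree `RootDecomp1KSiegelGenusOne.xDisc_W4P`) is NOT a square in `ℚ̄[Y]`: it is separable —
CERTIFICATE 2 (checked in-kernel by `ring`, the derivative `Δ′ = 6Y⁵ − 20Y⁴ − 32Y³ + 6Y² + 68` by `simp`):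
`U·Δ + V·Δ′ = 881255087104` with `U = 409305702·Y⁴ − 2178674218·Y³ + 1985160538·Y² − 3919276356·Y + 9047367012`,
`V = −68217617·Y⁵ + 408590781·Y⁴ − 239426653·Y³ + 384598499·Y² − 1151177883·Y − 5268149905` (extended Euclid in
`ℚ[Y]`, denominators cleared; census bezout.py, critic L3486/L3490 and writer L3489 independently) — hence squarefree
(Mathlib `Separable.squarefree`), so a square root would be a unit and `deg Δ = 6` would be `0`.  (Δ misses a square by
exactly the tree's W4Coprime03 norm identity: `(Y³ − 2Y² − 6Y − 11)² − Δ = 16(5Y − 1)(Y + 1)`.) -/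

section Irreducible

variable {k : Type*} [Field k]

/-- the `x²`-, `x`- and constant coefficients of `C A * X ^ 2 + C B * X + C C₀`. -/
theorem coeff_quadratic_two_one_zero (A B C₀ : k[X]) :
    (C A * X ^ 2 + C B * X + C C₀ : k[X][X]).coeff 2 = A ∧ (C A * X ^ 2 + C B * X + C C₀ : k[X][X]).coeff 1 = B ∧
      (C A * X ^ 2 + C B * X + C C₀ : k[X][X]).coeff 0 = C₀ := by
  refine ⟨?_, ?_, ?_⟩ <;> simp [coeff_X, coeff_C, coeff_X_pow]

/-- **a primitive `x`-quadratic over `k[Y]` with non-square discriminant is irreducible in `k[Y][x]`**: if `A ≠ 0`,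
`A` and `B` generate a non-zero constant (`U·A + V·B = D ≠ 0`), and `B² − 4AC₀` is not a square in `k[Y]`, then
`A·x² + B·x + C₀` is irreducible (a constant factor divides `A` and `B`, hence `D`, hence is a unit; two `x`-linear factors
`(αx + β)(γx + δ)` give `B² − 4AC₀ = (αδ − βγ)²`). -/
theorem irreducible_quadratic_of_disc_not_sq {A B C₀ : k[X]} (hA : A ≠ 0)
    (hcop : ∃ U V : k[X], ∃ D : k, D ≠ 0 ∧ U * A + V * B = C D)
    (hdisc : ∀ s : k[X], B ^ 2 - 4 * A * C₀ ≠ s ^ 2) :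
    Irreducible (C A * X ^ 2 + C B * X + C C₀ : k[X][X]) := by
  obtain ⟨hc2, hc1, hc0⟩ := coeff_quadratic_two_one_zero A B C₀
  set F : k[X][X] := C A * X ^ 2 + C B * X + C C₀ with hFdef
  have hF2 : F.natDegree = 2 := natDegree_quadratic hA
  have hF0 : F ≠ 0 := fun h => by rw [h, natDegree_zero] at hF2; exact absurd hF2 (by norm_num)
  -- a constant dividing `F` divides `A` and `B`, hence the non-zero constant `D`: it is a unit
  have hunitC : ∀ r : k[X], C r ∣ F → IsUnit (C r : k[X][X]) := by
    intro r hr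
    rw [C_dvd_iff_dvd_coeff] at hr
    obtain ⟨U, V, D, hD, hUV⟩ := hcop
    have h2 := hr 2
    have h1 := hr 1
    rw [hc2] at h2
    rw [hc1] at h1
    have hdvd : r ∣ C D := by
      rw [← hUV]; exact dvd_add (dvd_mul_of_dvd_right h2 _) (dvd_mul_of_dvd_right h1 _)
    exact isUnit_C.mpr (isUnit_of_dvd_unit hdvd (isUnit_C.mpr (isUnit_iff_ne_zero.mpr hD)))
  refine irreducible_iff.mpr ⟨fun hu => ?_, fun g h hgh => ?_⟩
  · have h0 := natDegree_eq_zero_of_isUnit hu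
    rw [hF2] at h0
    exact absurd h0 (by norm_num)
  · have hg0 : g ≠ 0 := by rintro rfl; rw [zero_mul] at hgh; exact hF0 hgh
    have hh0 : h ≠ 0 := by rintro rfl; rw [mul_zero] at hgh; exact hF0 hgh
    have hdeg : g.natDegree + h.natDegree = 2 := by rw [← natDegree_mul hg0 hh0, ← hgh, hF2]
    by_cases hg : g.natDegree = 0
    · left
      rw [eq_C_of_natDegree_eq_zero hg]
      refine hunitC _ ⟨h, ?_⟩
      rw [← eq_C_of_natDegree_eq_zero hg]; exact hgh
    by_cases hh : h.natDegree = 0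
    · right
      rw [eq_C_of_natDegree_eq_zero hh]
      refine hunitC _ ⟨g, ?_⟩
      rw [← eq_C_of_natDegree_eq_zero hh, mul_comm]; exact hgh
    -- both factors are `x`-linear: the discriminant is a square
    exfalso
    have hg1 : g.natDegree ≤ 1 := by omega
    have hh1 : h.natDegree ≤ 1 := by omega
    have hgf := eq_X_add_C_of_natDegree_le_one hg1
    have hhf := eq_X_add_C_of_natDegree_le_one hh1
    set α := g.coeff 1
    set β := g.coeff 0
    set γ := h.coeff 1
    set δ := h.coeff 0
    have hprod : F = C (α * γ) * X ^ 2 + C (α * δ + β * γ) * X + C (β * δ) := by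
      rw [hgh, hgf, hhf]; simp only [map_add, map_mul]; ring
    obtain ⟨hp2, hp1, hp0⟩ := coeff_quadratic_two_one_zero (α * γ) (α * δ + β * γ) (β * δ)
    have e2 : A = α * γ := by rw [← hc2, hprod, hp2]
    have e1 : B = α * δ + β * γ := by rw [← hc1, hprod, hp1]
    have e0 : C₀ = β * δ := by rw [← hc0, hprod, hp0]
    exact hdisc (α * δ - β * γ) (by rw [e2, e1, e0]; ring)

end Irreducible

/-- `swap W4P = (Y + 2) + x·(Y³ + 1) + x²·(Y⁴ − 17)` in `ℤ[Y][x]` (Mathlib `Bivariate.swap`: the outer variable is now `x`). -/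
theorem swap_W4P : Bivariate.swap W4P = C (X + C 2) + Y * C vG + Y ^ 2 * C vQ := by
  rw [W4P, xPolyP]
  simp only [Finset.sum_range_succ, Finset.sum_range_zero, zero_add, map_add, map_mul, map_pow,
    Bivariate.swap_X, Bivariate.swap_map_C, w4C]
  simp

/-- the geometric model of the swapped curve: `(Y⁴ − 17)·x² + (Y³ + 1)·x + (Y + 2) ∈ ℚ̄[Y][x]`. -/
theorem geomModel_swap_W4P : (Bivariate.swap W4P).map (mapRingHom (algebraMap ℤ (AlgebraicClosure ℚ))) =
    C (X ^ 4 - 17) * X ^ 2 + C (X ^ 3 + 1) * X + C (X + 2) := by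
  rw [swap_W4P]
  simp [vG, vQ, Polynomial.map_ofNat]
  ring

/-- `A = Y⁴ − 17 ≠ 0` in `ℚ̄[Y]`. -/
theorem geomA_ne_zero : (X ^ 4 - 17 : (AlgebraicClosure ℚ)[X]) ≠ 0 := by
  have h : (X ^ 4 - 17 : (AlgebraicClosure ℚ)[X]).natDegree = 4 := by compute_degree!
  intro h0; rw [h0, natDegree_zero] at h; exact absurd h (by norm_num)

/-- `gcd(A, B) = 1`: `(−Y² + 17Y − 289)·(Y⁴ − 17) + (Y³ − 17Y² + 289Y − 1)·(Y³ + 1) = 4912`. -/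
theorem geomA_geomB_coprime : ∃ U V : (AlgebraicClosure ℚ)[X], ∃ D : AlgebraicClosure ℚ, D ≠ 0 ∧
    U * (X ^ 4 - 17) + V * (X ^ 3 + 1) = C D := by
  refine ⟨-X ^ 2 + 17 * X - 289, X ^ 3 - 17 * X ^ 2 + 289 * X - 1, 4912, by norm_num, ?_⟩
  rw [map_ofNat C 4912]; ring

/-- the discriminant `Δ = B² − 4AC₀ = Y⁶ − 4Y⁵ − 8Y⁴ + 2Y³ + 68Y + 137` (tree `RootDecomp1KSiegelGenusOne.xDisc_W4P` is the
`ℤ[Y]` form). -/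
theorem geomDisc_eq : ((X ^ 3 + 1) ^ 2 - 4 * (X ^ 4 - 17) * (X + 2) : (AlgebraicClosure ℚ)[X]) =
    X ^ 6 - 4 * X ^ 5 - 8 * X ^ 4 + 2 * X ^ 3 + 68 * X + 137 := by ring

/-- `Δ′ = 6Y⁵ − 20Y⁴ − 32Y³ + 6Y² + 68`. -/
theorem derivative_geomDisc :
    derivative (X ^ 6 - 4 * X ^ 5 - 8 * X ^ 4 + 2 * X ^ 3 + 68 * X + 137 : (AlgebraicClosure ℚ)[X]) =
      6 * X ^ 5 - 20 * X ^ 4 - 32 * X ^ 3 + 6 * X ^ 2 + 68 := by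
  simp only [derivative_add, derivative_sub, derivative_mul, derivative_X_pow, derivative_X, derivative_ofNat,
    Nat.cast_ofNat, map_ofNat, zero_mul, zero_add, mul_one]
  norm_num
  ring

/-- **`Δ` is separable over `ℚ̄`**: the integer Bézout identity `U·Δ + V·Δ′ = 881255087104` (extended Euclid in `ℚ[Y]`,
denominators cleared), so `(U/D)·Δ + (V/D)·Δ′ = 1`. -/
theorem separable_geomDisc :
    (X ^ 6 - 4 * X ^ 5 - 8 * X ^ 4 + 2 * X ^ 3 + 68 * X + 137 : (AlgebraicClosure ℚ)[X]).Separable := by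
  set Δ : (AlgebraicClosure ℚ)[X] := X ^ 6 - 4 * X ^ 5 - 8 * X ^ 4 + 2 * X ^ 3 + 68 * X + 137 with hΔ
  set U : (AlgebraicClosure ℚ)[X] :=
    409305702 * X ^ 4 - 2178674218 * X ^ 3 + 1985160538 * X ^ 2 - 3919276356 * X + 9047367012 with hU
  set V : (AlgebraicClosure ℚ)[X] :=
    -68217617 * X ^ 5 + 408590781 * X ^ 4 - 239426653 * X ^ 3 + 384598499 * X ^ 2 - 1151177883 * X - 5268149905
    with hV
  have hbez : U * Δ + V * derivative Δ = C 881255087104 := by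
    rw [hΔ, derivative_geomDisc, map_ofNat C 881255087104, hU, hV]; ring
  have hD : (881255087104 : AlgebraicClosure ℚ) ≠ 0 := by norm_num
  refine ⟨C (881255087104 : AlgebraicClosure ℚ)⁻¹ * U, C (881255087104 : AlgebraicClosure ℚ)⁻¹ * V, ?_⟩
  rw [mul_assoc, mul_assoc, ← mul_add, hbez, ← map_mul, inv_mul_cancel₀ hD, map_one]

/-- **`Δ` is not a square in `ℚ̄[Y]`** (separable ⇒ squarefree ⇒ a square root would be a unit ⇒ `deg Δ = 0 ≠ 6`). -/
theorem geomDisc_ne_sq (s : (AlgebraicClosure ℚ)[X]) :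
    ((X ^ 3 + 1) ^ 2 - 4 * (X ^ 4 - 17) * (X + 2) : (AlgebraicClosure ℚ)[X]) ≠ s ^ 2 := by
  rw [geomDisc_eq]
  intro hs
  have hu : IsUnit s := separable_geomDisc.squarefree s (by rw [hs, sq])
  have h6 : (X ^ 6 - 4 * X ^ 5 - 8 * X ^ 4 + 2 * X ^ 3 + 68 * X + 137 : (AlgebraicClosure ℚ)[X]).natDegree = 6 := by
    compute_degree!
  rw [hs, natDegree_pow, natDegree_eq_zero_of_isUnit hu, mul_zero] at h6
  exact absurd h6 (by norm_num)

/-- **`W4` IS GEOMETRICALLY IRREDUCIBLE** — hypothesis-free (`GeomIrreducible W4P`: `W4P` irreducible in `ℚ̄[x][Y]`). -/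
theorem geomIrreducible_W4P : GeomIrreducible W4P := by
  rw [← geomIrreducible_swap_iff]
  unfold GeomIrreducible
  rw [geomModel_swap_W4P]
  exact irreducible_quadratic_of_disc_not_sq geomA_ne_zero geomA_geomB_coprime geomDisc_ne_sq

/-! ### §5  The member `W4` at `m₀ = 2`: ON the boundary (`deg_Y W4P = 4 = 2 · xdeg W4P`) -/

/-- `W4` sits on the boundary of node 12's grading at `m₀ = 2`: `natDegree W4P = 2 * xdeg W4P`. -/
theorem boundary_W4P : W4P.natDegree = 2 * xdeg W4P := by rw [natDegree_W4P, xdeg_W4P]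

/-- **THE MEMBER (per curve)**: if the `O(√h)` comparison holds on `W4` (Néron's theorem for the one genus-2 curve
`X : z² = Δ(Y)`), then `ThinFibreAt 2 W4P ↔ LevelFinite W4P` — the ×1 item of record «W4 at m₀ = 2» has ONE currency:
finiteness of the bounded level sets; the clause `den r^{2N} > C·2^{(N+1)!}` fails at every bounded level point of every
large level. -/
theorem thinFibreAt_two_W4P_iff_levelFinite (hW : SqrtComparisonAt W4P) : ThinFibreAt 2 W4P ↔ LevelFinite W4P :=
  thinFibreAt_iff_levelFinite_boundary hW (by rw [xdeg_W4P]; norm_num) (by norm_num) boundary_W4P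

/-- Néron's theorem applies to `W4` (geometrically irreducible, `xdeg = 2 ≥ 1`, `deg_Y = 4 ≥ 1`): the binder gives the
per-curve instance. -/
theorem sqrtComparisonAt_W4P (hH : HeightComparisonSqrt) : SqrtComparisonAt W4P :=
  hH W4P geomIrreducible_W4P (by rw [xdeg_W4P]; norm_num) (by rw [natDegree_W4P]; norm_num)

/-- **THE MEMBER (modulo the binder)**: `ThinFibreAt 2 W4P ↔ LevelFinite W4P`, modulo `HeightComparisonSqrt`. -/
theorem thinFibreAt_two_W4P_iff_levelFinite_of_sqrt (hH : HeightComparisonSqrt) : ThinFibreAt 2 W4P ↔ LevelFinite W4P :=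
  thinFibreAt_two_W4P_iff_levelFinite (sqrtComparisonAt_W4P hH)

/-- `ThinFibreAt 2 W4P ↔ BddLevelEmpty W4P` (same, in node 12's wording). -/
theorem thinFibreAt_two_W4P_iff_bddLevelEmpty (hW : SqrtComparisonAt W4P) : ThinFibreAt 2 W4P ↔ BddLevelEmpty W4P :=
  thinFibreAt_iff_bddLevelEmpty_boundary hW (by rw [xdeg_W4P]; norm_num) (by norm_num) boundary_W4P

/-- **TWO PRINT THEOREMS GIVE LEVEL FINITENESS FOR `W4`**: Schlickewei's `p`-adic Subspace Theorem (node 11's binder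
`PadicSubspace`, through the tree's `thinFibreAt_W4P_of_padicSubspace`) and Néron's comparison on `W4` together yield
`LevelFinite W4P` — neither is proved in the tree; row 36 stays UNDECIDED OF RECORD. -/
theorem levelFinite_W4P_of_padicSubspace_of_sqrt (hS : PadicSubspace) (hW : SqrtComparisonAt W4P) : LevelFinite W4P :=
  (thinFibreAt_two_W4P_iff_levelFinite hW).mp (thinFibreAt_W4P_of_padicSubspace hS le_rfl)

end Summit.Schanuel.Schanuel.Theorems.RootDecomp1KHeightBoundary

end
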